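import Summits.BirchSwinnertonDyer.BirchSwinnertonDyer.Theorems.EisensteinPrimesMazurMCOnCellBTwistbackTwistDoorDictionary
import HarnessLib

/-!
# Crux 3 `MazurMCOnCellB` (stmt-BirchSwinnertonDyer-19033), line `twistback` v4 — the TWIST DOOR FROM THE
# `W`-SIDE, part 5: the PARITY of the line characters from the parity of the line — the hypotheses
# `ψ even` / `φ even` of parts 3–4 DERIVED (complex conjugation has cyclotomic value `−1`)

Width seat bsd-line-x2-p1-w3 (gen 9), cell `bsd-eis` (run/shared/lean/pub/bsd-eis/), 2026-08-28. HONEST FRAMING: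
THEOREMS ONLY (no `def`, no named fact introduced, no `sorry`); Galois-module / Dirichlet-character algebra + the two
`p = 3` doors of part 4 re-stated WITHOUT their parity hypothesis; `--supports` stmt-BirchSwinnertonDyer-19033; closes no
stub by itself; conditional exactly as part 4 §2 (PublishedInputs, Disegni Thm. 4(1), GV Thm. (3.11), Dokchitser — PUB;
Keller–Yin Thm. E — PRE; Nakagawa–Horie–Taya — PUB named fact); no summit statement, no Mazur main conjecture and no BSD
is proved for any curve; 0 cells / labels / tiers move.

* §1 `apply_neg_one_eq_intCast_of_line` — if a complex conjugation `c` acts on the rational line `Φ₀` as the integer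
  `a`, its Dirichlet character has `φ(−1) = a` in `𝔽_p` (`χ_m(c) = −1`, tree
  `modNCyclotomicCharacter_of_isComplexConjugation`; a point of the line has order `p`); hence
  `apply_neg_one_of_lineOdd` (`Φ₀` odd ⟹ `φ(−1) = −1`) and `even_of_lineEven` (`Φ₀` even ⟹ `φ` even);
  `even_of_apply_neg_one_of_weil` — `φ(−1) = −1` and the Weil relation `φ(a)a⁻¹ = ψ⁻¹(a)` (`p ∤ a`) ⟹ `ψ` even
  (evaluate at `a = pmd − 1 ≡ −1`).
* §2 `upperPartner_at_three_of_ramifiedOddLine_of_thmE` / `upperPartner_at_three_of_unramifiedEvenLine_of_thmE` —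
  part 4 §2 (w5's p652304 with `hDict` discharged) WITHOUT the hypothesis `ψ.Even` resp. `φ.Even`.

References: [GreenbergVatsal2000] Thm. (1.3) («even», «odd»), §2 p. 28 (φψ = ω); [Washington1997] p. 19 (χ(−1) = χ(c));
[DeligneSerre1974] 4.5.
-/

set_option autoImplicit false

-- `Summit.BirchSwinnertonDyer.BirchSwinnertonDyer.…`: the summit and its single sub-problem share a name.
set_option linter.dupNamespace false

noncomputable section

open scoped Classical NumberTheorySymbols

open WeierstrassCurve NumberField IsDedekindDomain Field DirichletCharacter
  Literature.NumberTheory.EllipticCurves Literature.NumberTheory.GaloisRepresentations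
  Literature.NumberTheory.EllipticCurves.GreenbergVatsal2000
  Literature.NumberTheory.EllipticCurves.Rank1Residual Literature.NumberTheory.EllipticCurves.Rank1Residual.Typed
  Literature.NumberTheory.EllipticCurves.Disegni2020 Literature.NumberTheory.EllipticCurves.KellerYin2024
  Literature.NumberTheory.QuadraticFields Literature.NumberTheory.QuadraticFields.Quadratic
  Summit.BirchSwinnertonDyer.Rank1Residual Summit.BirchSwinnertonDyer.Rank1Residual.X2
  Summit.BirchSwinnertonDyer.BirchSwinnertonDyer.Theses
  Summit.BirchSwinnertonDyer.BirchSwinnertonDyer.Theorems.EisensteinPrimesMazurMCOnCellBTwistbackTwistDoor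
  Summit.BirchSwinnertonDyer.BirchSwinnertonDyer.Theorems.EisensteinPrimesMazurMCOnCellBTwistbackTwistDoorClassNumber
  Summit.BirchSwinnertonDyer.BirchSwinnertonDyer.Theorems.EisensteinPrimesMazurMCOnCellBTwistbackTwistDoorDictionary

namespace Summit.BirchSwinnertonDyer.BirchSwinnertonDyer.Theorems.EisensteinPrimesMazurMCOnCellBTwistbackTwistDoorParity

/-! ## §1. The parity of the line characters -/

/-- **The value at `−1` of the character of a rational line is read off a complex conjugation**: if `c` (a complex
conjugation of `Γ_ℚ`) acts on `Φ₀` as the integer `a`, then `φ(−1) = a` in `𝔽_p` — `χ_m(c) = −1`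
(`modNCyclotomicCharacter_of_isComplexConjugation`) and a non-zero point of the line has order `p`.
[cite: Washington1997, p. 19 (χ(−1) = χ(c))] [cite: GreenbergVatsal2000, Thm. (1.3)] -/
theorem apply_neg_one_eq_intCast_of_line {W : WeierstrassCurve ℚ} {p : ℕ} [Fact p.Prime]
    {Φ₀ : AddSubgroup (geomTorsion W (p : ℤ))} (hΦ : IsRationalLine W p Φ₀)
    {m : ℕ} [NeZero m] (φ : DirichletCharacter (ZMod p) m)
    (hφ0 : ∀ (σ : absoluteGaloisGroup ℚ), ∀ P ∈ Φ₀,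
      σ • P = (φ ((modNCyclotomicCharacter ℚ m σ : (ZMod m)ˣ) : ZMod m)).val • P)
    {c : absoluteGaloisGroup ℚ} (hc : IsComplexConjugation (Rat.castHom ℝ) c) {a : ℤ}
    (h : ∀ P ∈ Φ₀, c • P = a • P) : φ (-1) = ((a : ℤ) : ZMod p) := by
  have hp : p.Prime := Fact.out
  -- a non-zero point of the line; it has order `p`
  obtain ⟨P, hP, hP0⟩ : ∃ P ∈ Φ₀, P ≠ 0 := by
    by_contra hne
    push Not at hne
    haveI : Subsingleton Φ₀ := ⟨fun x y ↦ Subtype.ext (by rw [hne x.1 x.2, hne y.1 y.2])⟩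
    have h1 : Nat.card Φ₀ = 1 := Nat.card_of_subsingleton (0 : Φ₀)
    rw [hΦ.1] at h1
    exact hp.one_lt.ne' h1
  have hord : addOrderOf P = p := by
    have hdvd := addOrderOf_dvd_natCard (⟨P, hP⟩ : Φ₀)
    rw [hΦ.1, AddSubgroup.addOrderOf_mk] at hdvd
    rcases (Nat.dvd_prime hp).mp hdvd with h1 | h1
    · exact absurd (AddMonoid.addOrderOf_eq_one_iff.mp h1) hP0
    · exact h1
  have hcm : ((modNCyclotomicCharacter ℚ m c : (ZMod m)ˣ) : ZMod m) = -1 :=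
    modNCyclotomicCharacter_of_isComplexConjugation hc
  have hval : ((φ (-1)).val : ℤ) • P = a • P := by
    rw [natCast_zsmul, ← hcm, ← hφ0 c P hP, h P hP]
  have hdvd : (addOrderOf P : ℤ) ∣ a - ((φ (-1)).val : ℤ) := by
    rw [addOrderOf_dvd_iff_zsmul_eq_zero, sub_zsmul, hval, add_neg_cancel]
  rw [hord] at hdvd
  have hcong : (((φ (-1)).val : ℤ) : ZMod p) = ((a : ℤ) : ZMod p) :=
    (ZMod.intCast_eq_intCast_iff_dvd_sub _ _ p).mpr hdvd
  rwa [Int.cast_natCast, ZMod.natCast_zmod_val] at hcong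

/-- **An ODD rational line has `φ(−1) = −1`.** [cite: GreenbergVatsal2000, Thm. (1.3) («odd»)] -/
theorem apply_neg_one_of_lineOdd {W : WeierstrassCurve ℚ} {p : ℕ} [Fact p.Prime]
    {Φ₀ : AddSubgroup (geomTorsion W (p : ℤ))} (hΦ : IsRationalLine W p Φ₀) (hodd : LineOdd W p Φ₀)
    {m : ℕ} [NeZero m] (φ : DirichletCharacter (ZMod p) m)
    (hφ0 : ∀ (σ : absoluteGaloisGroup ℚ), ∀ P ∈ Φ₀,
      σ • P = (φ ((modNCyclotomicCharacter ℚ m σ : (ZMod m)ˣ) : ZMod m)).val • P) :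
    φ (-1) = -1 := by
  obtain ⟨c, hc⟩ := exists_isComplexConjugation (Rat.castHom ℝ)
  have h := apply_neg_one_eq_intCast_of_line hΦ φ hφ0 hc (a := -1) fun P hP ↦ by
    rw [neg_one_zsmul]; exact hodd c hc P hP
  rw [h, Int.cast_neg, Int.cast_one]

/-- **An EVEN rational line has an even character `φ`.** [cite: GreenbergVatsal2000, Thm. (1.3) («even»)] -/
theorem even_of_lineEven {W : WeierstrassCurve ℚ} {p : ℕ} [Fact p.Prime]
    {Φ₀ : AddSubgroup (geomTorsion W (p : ℤ))} (hΦ : IsRationalLine W p Φ₀) (heven : LineEven W p Φ₀)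
    {m : ℕ} [NeZero m] (φ : DirichletCharacter (ZMod p) m)
    (hφ0 : ∀ (σ : absoluteGaloisGroup ℚ), ∀ P ∈ Φ₀,
      σ • P = (φ ((modNCyclotomicCharacter ℚ m σ : (ZMod m)ˣ) : ZMod m)).val • P) :
    φ.Even := by
  obtain ⟨c, hc⟩ := exists_isComplexConjugation (Rat.castHom ℝ)
  have h := apply_neg_one_eq_intCast_of_line hΦ φ hφ0 hc (a := 1) fun P hP ↦ by
    rw [one_zsmul]; exact heven c hc P hP
  rw [Int.cast_one] at h
  exact h

/-- **`φ(−1) = −1` and the Weil relation `φ(a)a⁻¹ = ψ⁻¹(a)` (`p ∤ a`) make `ψ` even** (evaluate at `a = pmd − 1 ≡ −1`: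
`(−1)(−1)⁻¹ = ψ(−1)⁻¹`). [cite: GreenbergVatsal2000, §2 p. 28 (φψ = ω: ω is odd)] -/
theorem even_of_apply_neg_one_of_weil {p m d : ℕ} [Fact p.Prime] [NeZero m] [NeZero d]
    (φ : DirichletCharacter (ZMod p) m) (ψ : DirichletCharacter (ZMod p) d) (hφ1 : φ (-1) = -1)
    (hφψ : ∀ a : ℕ, ¬ p ∣ a → φ (a : ZMod m) * (a : ZMod p)⁻¹ = ψ⁻¹ (a : ZMod d)) : ψ.Even := by
  have hp : p.Prime := Fact.out
  have h0 : p * m * d ≠ 0 := Nat.mul_ne_zero (Nat.mul_ne_zero hp.ne_zero (NeZero.ne m)) (NeZero.ne d)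
  have h1 : 1 ≤ p * m * d := Nat.one_le_iff_ne_zero.mpr h0
  have hcast : ∀ n : ℕ, n ∣ p * m * d → ((p * m * d - 1 : ℕ) : ZMod n) = -1 := by
    intro n hn
    obtain ⟨k, hk⟩ := hn
    rw [Nat.cast_sub h1, Nat.cast_one, hk, Nat.cast_mul, ZMod.natCast_self, zero_mul, zero_sub]
  have hpd : p ∣ p * m * d := dvd_mul_of_dvd_left (dvd_mul_right p m) d
  have hnd : ¬ p ∣ p * m * d - 1 := by
    intro h
    have h1' := Nat.dvd_sub hpd h
    rw [Nat.sub_sub_self h1] at h1'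
    exact hp.one_lt.ne' (Nat.dvd_one.mp h1')
  have h := hφψ _ hnd
  rw [hcast m (dvd_mul_of_dvd_left (dvd_mul_left m p) d), hcast p hpd, hcast d (dvd_mul_left d (p * m)), hφ1,
    inv_neg_one, neg_one_mul, neg_neg, MulChar.inv_apply_eq_inv', eq_comm, inv_eq_one] at h
  exact h

/-! ## §2. Part 4 §2 without the parity hypothesis -/

/-- **Stub 6 at a NON-split X2b pair `(W, 3)` from the `W`-side line datum, FIRST SHAPE, parity DERIVED** — part 4's
`upperPartner_at_three_of_lineRamifiedOdd_of_thmE` (w5's p652304 with `hDict` discharged) WITHOUT the hypothesis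
`ψ.Even`: the line is odd, so `φ(−1) = −1` (§1) and the Weil relation makes `ψ` even. Remaining `W`-side inputs: the
ramified-odd `3`-line datum with primitive `(φ, ψ)`, `3 ∣ m`, `3 ∤ d`, `m ∣ 3d`, `d` a positive fundamental discriminant,
the Weil relation, `ψ(3) ≠ 1`, `S₀`, the balance `1`. Conditional as part 4 §2; nothing proved about any curve
unconditionally. [claim: KellerYin2024, status: under-review] [cite: NakagawaHorie1988, Thm. 1]
[cite: GreenbergVatsal2000, Thm. (1.3), §2 p. 28, §3 Thm. (3.11), (28)] [cite: Disegni2020, Thm. 4 (§3.2)]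
[cite: Wuthrich2014, Thm. 16 (p. 397)] [cite: DokchitserDokchitserAnnals2010, Thm. 1.4] [cite: Washington1997, Thm. 4.17] -/
theorem upperPartner_at_three_of_ramifiedOddLine_of_thmE
    (hP : EisensteinPrimes.PublishedInputs)
    (hDis : padicBSD_rankOne_nonsplitMult) (h311 : thm311_hasUnitContent_iff_and_order_eq_of_lineRamifiedEven)
    (hDD : ∀ (V : WeierstrassCurve ℚ) [V.IsElliptic] (ℓ : ℕ) [Fact ℓ.Prime], selmerCorank_mod_two_eq V ℓ)
    (hKY : thmE_pConverse_semistable_OPEN)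
    (hNH : Literature.NumberTheory.QuadraticFields.nakagawaHorie_taya_exists_imaginary_h3_eq_one)
    (W : WeierstrassCurve ℚ) [W.IsElliptic] [W.IsGloballyMinimal]
    (hc : X2.CellB W 3) (hns : ¬ W.HasSplitMultiplicativeReductionAtPrime 3)
    {Φ₀ : AddSubgroup (geomTorsion W ((3 : ℕ) : ℤ))} (hΦ : IsRationalLine W 3 Φ₀)
    (hram : ¬ LineUnramifiedAt W 3 Φ₀) (hoddL : LineOdd W 3 Φ₀)
    {m : ℕ} [NeZero m] (φ : DirichletCharacter (ZMod 3) m) {d : ℕ} [NeZero d]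
    (ψ : DirichletCharacter (ZMod 3) d) (hφ : φ.IsPrimitive) (hψ : ψ.IsPrimitive) (h3m : 3 ∣ m)
    (h3d : ¬ 3 ∣ d) (hm3d : m ∣ 3 * d)
    (hDf : ((d : ℤ) % 4 = 1 ∧ Squarefree (d : ℤ) ∧ (d : ℤ) ≠ 1) ∨
      (4 ∣ (d : ℤ) ∧ ((d : ℤ) / 4 % 4 = 2 ∨ (d : ℤ) / 4 % 4 = 3) ∧ Squarefree ((d : ℤ) / 4)))
    (hφ0 : ∀ (σ : absoluteGaloisGroup ℚ), ∀ P ∈ Φ₀,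
      σ • P = (φ ((modNCyclotomicCharacter ℚ m σ : (ZMod m)ˣ) : ZMod m)).val • P)
    (hψ0 : ∀ (σ : absoluteGaloisGroup ℚ) (P : geomTorsion W ((3 : ℕ) : ℤ)),
      σ • P - (ψ ((modNCyclotomicCharacter ℚ d σ : (ZMod d)ˣ) : ZMod d)).val • P ∈ Φ₀)
    (S₀ : Finset (HeightOneSpectrum (𝓞 ℚ))) (hS₀p : ∀ v ∈ S₀, ((3 : ℕ) : 𝓞 ℚ) ∉ v.asIdeal)
    (hS₀N : ∀ v ∈ S₀, Rat.HeightOneSpectrum.natGenerator v ∣ W.conductorNorm ℤ)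
    (hS : ∀ v : HeightOneSpectrum (𝓞 ℚ), v ∉ S₀ → ((3 : ℕ) : 𝓞 ℚ) ∉ v.asIdeal → W.HasGoodReductionAt v)
    (hψ3 : ψ (3 : ZMod d) ≠ 1)
    (hφψ : ∀ a : ℕ, ¬ 3 ∣ a → φ (a : ZMod m) * (a : ZMod 3)⁻¹ = ψ⁻¹ (a : ZMod d))
    (hbal : 1 + ∑ v ∈ S₀, delta W 3 v =
      ∑ v ∈ S₀, ((if φ (Rat.HeightOneSpectrum.natGenerator v : ZMod m) =
            (Rat.HeightOneSpectrum.natGenerator v : ZMod 3)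
          then sFactor 3 (Rat.HeightOneSpectrum.natGenerator v) else 0) +
        (if ψ (Rat.HeightOneSpectrum.natGenerator v : ZMod d) =
            (Rat.HeightOneSpectrum.natGenerator v : ZMod 3)
          then sFactor 3 (Rat.HeightOneSpectrum.natGenerator v) else 0))) :
    ∃ (K : Type) (_ : Field K) (_ : NumberField K), IsImaginaryQuadratic K ∧
      SatisfiesHeegnerHypothesis (W.conductorNorm ℤ) K ∧ SatisfiesHeegnerHypothesis 3 K ∧
      Odd (NumberField.discr K) ∧ NumberField.discr K < -4 ∧
      (W.quadraticTwist (NumberField.discr K : ℚ)).analyticRank = 1 ∧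
      ∀ (Wd : WeierstrassCurve ℚ) [Wd.IsElliptic] [Wd.IsGloballyMinimal],
        (∃ C : VariableChange ℚ, C • Wd = W.quadraticTwist (NumberField.discr K : ℚ)) →
        MissingUpperBoundAt Wd 3 :=
  EisensteinPrimesMazurMCOnCellBTwistbackTwistDoorDictionary.upperPartner_at_three_of_lineRamifiedOdd_of_thmE hP hDis
    h311 hDD hKY hNH W hc hns hΦ hram hoddL φ ψ hφ hψ h3m h3d hm3d hDf hφ0 hψ0 S₀ hS₀p hS₀N hS
    (even_of_apply_neg_one_of_weil φ ψ (apply_neg_one_of_lineOdd hΦ hoddL φ hφ0) hφψ) hψ3 hφψ hbal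

/-- **Stub 6 at a NON-split X2b pair `(W, 3)` from the `W`-side line datum, SECOND SHAPE, parity DERIVED** — part 4's
`upperPartner_at_three_of_lineUnramifiedEven_of_thmE` WITHOUT the hypothesis `φ.Even` (the line is even, §1).
[claim: KellerYin2024, status: under-review] [cite: NakagawaHorie1988, Thm. 1]
[cite: GreenbergVatsal2000, Thm. (1.3), §2 p. 28, §3 Thm. (3.11), (28)] [cite: Disegni2020, Thm. 4 (§3.2)]
[cite: Wuthrich2014, Thm. 16 (p. 397)] [cite: SilvermanATAEC1994, Thm. V.5.3, Cor. V.5.4] [cite: Washington1997, Thm. 4.17] -/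
theorem upperPartner_at_three_of_unramifiedEvenLine_of_thmE
    (hP : EisensteinPrimes.PublishedInputs)
    (hDis : padicBSD_rankOne_nonsplitMult) (h311 : thm311_hasUnitContent_iff_and_order_eq_of_lineRamifiedEven)
    (hDD : ∀ (V : WeierstrassCurve ℚ) [V.IsElliptic] (ℓ : ℕ) [Fact ℓ.Prime], selmerCorank_mod_two_eq V ℓ)
    (hKY : thmE_pConverse_semistable_OPEN)
    (hNH : Literature.NumberTheory.QuadraticFields.nakagawaHorie_taya_exists_imaginary_h3_eq_one)
    (W : WeierstrassCurve ℚ) [W.IsElliptic] [W.IsGloballyMinimal]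
    (hc : X2.CellB W 3) (hns : ¬ W.HasSplitMultiplicativeReductionAtPrime 3)
    {Φ₀ : AddSubgroup (geomTorsion W ((3 : ℕ) : ℤ))} (hΦ : IsRationalLine W 3 Φ₀)
    (hunr : LineUnramifiedAt W 3 Φ₀) (hevenL : LineEven W 3 Φ₀)
    {m : ℕ} [NeZero m] (φ : DirichletCharacter (ZMod 3) m) {d : ℕ} [NeZero d]
    (ψ : DirichletCharacter (ZMod 3) d) (hφ : φ.IsPrimitive) (hψ : ψ.IsPrimitive) (h3m : ¬ 3 ∣ m)
    (h3d : 3 ∣ d) (hd3m : d ∣ 3 * m)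
    (hDf : ((m : ℤ) % 4 = 1 ∧ Squarefree (m : ℤ) ∧ (m : ℤ) ≠ 1) ∨
      (4 ∣ (m : ℤ) ∧ ((m : ℤ) / 4 % 4 = 2 ∨ (m : ℤ) / 4 % 4 = 3) ∧ Squarefree ((m : ℤ) / 4)))
    (hφ0 : ∀ (σ : absoluteGaloisGroup ℚ), ∀ P ∈ Φ₀,
      σ • P = (φ ((modNCyclotomicCharacter ℚ m σ : (ZMod m)ˣ) : ZMod m)).val • P)
    (hψ0 : ∀ (σ : absoluteGaloisGroup ℚ) (P : geomTorsion W ((3 : ℕ) : ℤ)),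
      σ • P - (ψ ((modNCyclotomicCharacter ℚ d σ : (ZMod d)ˣ) : ZMod d)).val • P ∈ Φ₀)
    (S₀ : Finset (HeightOneSpectrum (𝓞 ℚ))) (hS₀p : ∀ v ∈ S₀, ((3 : ℕ) : 𝓞 ℚ) ∉ v.asIdeal)
    (hS₀N : ∀ v ∈ S₀, Rat.HeightOneSpectrum.natGenerator v ∣ W.conductorNorm ℤ)
    (hS : ∀ v : HeightOneSpectrum (𝓞 ℚ), v ∉ S₀ → ((3 : ℕ) : 𝓞 ℚ) ∉ v.asIdeal → W.HasGoodReductionAt v)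
    (hφ3 : φ (3 : ZMod m) ≠ 1)
    (hφψ : ∀ a : ℕ, ¬ 3 ∣ a → φ (a : ZMod m) * (a : ZMod 3)⁻¹ = ψ⁻¹ (a : ZMod d))
    (hbal : 1 + ∑ v ∈ S₀, delta W 3 v =
      ∑ v ∈ S₀, ((if φ (Rat.HeightOneSpectrum.natGenerator v : ZMod m) =
            (Rat.HeightOneSpectrum.natGenerator v : ZMod 3)
          then sFactor 3 (Rat.HeightOneSpectrum.natGenerator v) else 0) +
        (if ψ (Rat.HeightOneSpectrum.natGenerator v : ZMod d) =
            (Rat.HeightOneSpectrum.natGenerator v : ZMod 3)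
          then sFactor 3 (Rat.HeightOneSpectrum.natGenerator v) else 0))) :
    ∃ (K : Type) (_ : Field K) (_ : NumberField K), IsImaginaryQuadratic K ∧
      SatisfiesHeegnerHypothesis (W.conductorNorm ℤ) K ∧ SatisfiesHeegnerHypothesis 3 K ∧
      Odd (NumberField.discr K) ∧ NumberField.discr K < -4 ∧
      (W.quadraticTwist (NumberField.discr K : ℚ)).analyticRank = 1 ∧
      ∀ (Wd : WeierstrassCurve ℚ) [Wd.IsElliptic] [Wd.IsGloballyMinimal],
        (∃ C : VariableChange ℚ, C • Wd = W.quadraticTwist (NumberField.discr K : ℚ)) →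
        MissingUpperBoundAt Wd 3 :=
  EisensteinPrimesMazurMCOnCellBTwistbackTwistDoorDictionary.upperPartner_at_three_of_lineUnramifiedEven_of_thmE hP
    hDis h311 hDD hKY hNH W hc hns hΦ hunr hevenL φ ψ hφ hψ h3m h3d hd3m hDf hφ0 hψ0 S₀ hS₀p hS₀N hS
    (even_of_lineEven hΦ hevenL φ hφ0) hφ3 hφψ hbal

end Summit.BirchSwinnertonDyer.BirchSwinnertonDyer.Theorems.EisensteinPrimesMazurMCOnCellBTwistbackTwistDoorParity

end
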